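import Mathlib.Analysis.BoundedVariation
import Mathlib.Analysis.Complex.Basic
import Literature.Probability.Percolation.StripPiecesLine
import HarnessLib

/-!
# The pieces of the cut between the junction squares

Topic `Probability/Percolation`.  Support file (definitions and proofs, no named fact) for the zone
geometry of the proof of Schramm–Smirnov's Prop. 4.1 (Ann. Probab. 39 (2011), §4), per-strip form.
Input (`PathCoreData`): finitely many continuous paths `γ k : ℝ → ℂ` of bounded variation on
`[0, 1]` (the cut, extended to the line), a closed set `Qc` (the carrier of the quad), finitely many
open junction squares `coreSq (ctr c) (rad c)`, and finite sets of CUT parameters on each path whose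
points are bad (outside `Qc` or inside a square), `0` and `1` among them, consecutive ones at
variation `≤ η`; the paths meet the frontier of each square at finitely many parameters, meet the
frontier of `Qc` only inside the squares, and every multiple point of the cut lies inside a square.  Output: the PIECES — the images of the connected components
of the closed parameter sets `F k = {t ∈ [0,1] | γ k t ∈ Qc ∖ ⋃ squares}` — are finitely many
(`finite_pieces`), compact, connected, pairwise disjoint (`disjoint_piece`), of diameter `≤ η`
(`dist_le_of_mem_piece`), and cover `⋃ₖ γ k (F k)`; hence uniformly separated
(`StripPieces.exists_pos_forall_le_dist`).

## References

* O. Schramm, S. Smirnov, Ann. Probab. 39 (2011), arXiv:1101.5820, §4, proof of Prop. 4.1 (the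
  discs `B(x_i, s)`; "the intersection of α with ⋃ᵢ ∂B(xᵢ, s) is finite"). [SchrammSmirnov2011]
-/

noncomputable section

open Set Metric

namespace Literature.Probability.Percolation

namespace StripPieces

/-! ### Squares -/

/-- The open sup-norm square of half-width `r` about `z`. [folklore] -/
def coreSq (z : ℂ) (r : ℝ) : Set ℂ := {w | |w.re - z.re| < r ∧ |w.im - z.im| < r}

/-- The closed sup-norm square of half-width `r` about `z`. [folklore] -/
def coreSqCl (z : ℂ) (r : ℝ) : Set ℂ := {w | |w.re - z.re| ≤ r ∧ |w.im - z.im| ≤ r}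

/-- `isOpen_coreSq` (isOpen coreSq). [folklore] -/
theorem isOpen_coreSq (z : ℂ) (r : ℝ) : IsOpen (coreSq z r) :=
  (isOpen_lt (continuous_abs.comp (Complex.continuous_re.sub continuous_const)) continuous_const).inter
    (isOpen_lt (continuous_abs.comp (Complex.continuous_im.sub continuous_const)) continuous_const)

/-- `isClosed_coreSqCl` (isClosed coreSqCl). [folklore] -/
theorem isClosed_coreSqCl (z : ℂ) (r : ℝ) : IsClosed (coreSqCl z r) :=
  (isClosed_le (continuous_abs.comp (Complex.continuous_re.sub continuous_const)) continuous_const).inter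
    (isClosed_le (continuous_abs.comp (Complex.continuous_im.sub continuous_const)) continuous_const)

/-- `coreSq_subset_coreSqCl` (coreSq subset coreSqCl). [folklore] -/
theorem coreSq_subset_coreSqCl (z : ℂ) (r : ℝ) : coreSq z r ⊆ coreSqCl z r := fun _ h => ⟨h.1.le, h.2.le⟩

/-- `closure_coreSq_subset` (closure coreSq subset). [folklore] -/
theorem closure_coreSq_subset (z : ℂ) (r : ℝ) : closure (coreSq z r) ⊆ coreSqCl z r :=
  closure_minimal (coreSq_subset_coreSqCl z r) (isClosed_coreSqCl z r)

/-! ### The data -/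

/-- **Paths and junction squares**: the cut (paths of bounded variation on `[0,1]`, extended to the
line), the carrier, the open junction squares, the cut parameters, and the finiteness / multiple-point
hypotheses. [cite: SchrammSmirnov2011, §4, proof of Prop. 4.1 (the discs at the junction points)] -/
structure PathCoreData where
  /-- number of paths -/
  n : ℕ
  /-- the paths -/
  γ : Fin n → ℝ → ℂ
  γ_cont : ∀ k, Continuous (γ k)
  γ_bv : ∀ k, BoundedVariationOn (γ k) (Icc 0 1)
  /-- the carrier of the quad -/
  Qc : Set ℂ
  Qc_closed : IsClosed Qc
  /-- number of junction squares -/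
  M : ℕ
  /-- centres of the squares -/
  ctr : Fin M → ℂ
  /-- half-widths of the squares -/
  rad : Fin M → ℝ
  /-- the variation bound -/
  η : ℝ
  /-- the cut parameters -/
  CUT : Fin n → Finset ℝ
  cut_bad : ∀ k, ∀ t ∈ CUT k, γ k t ∈ Qc → ∃ c, γ k t ∈ coreSq (ctr c) (rad c)
  cut_zero : ∀ k, (0 : ℝ) ∈ CUT k
  cut_one : ∀ k, (1 : ℝ) ∈ CUT k
  cut_var : ∀ k, ∀ s ∈ CUT k, ∀ t ∈ CUT k, s < t → (∀ u ∈ CUT k, ¬ (s < u ∧ u < t)) →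
    eVariationOn (γ k) (Icc s t) ≤ ENNReal.ofReal η
  frontier_Q_core : ∀ k, ∀ t ∈ Icc (0 : ℝ) 1, γ k t ∈ frontier Qc → ∃ c, γ k t ∈ coreSq (ctr c) (rad c)
  fin_frontier_K : ∀ k c, {t : ℝ | t ∈ Icc (0 : ℝ) 1 ∧ γ k t ∈ frontier (coreSq (ctr c) (rad c))}.Finite
  multiple : ∀ k k' t t', t ∈ Icc (0 : ℝ) 1 → t' ∈ Icc (0 : ℝ) 1 → (k ≠ k' ∨ t ≠ t') → γ k t = γ k' t' →
    ∃ c, γ k t ∈ coreSq (ctr c) (rad c)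

namespace PathCoreData

variable (𝔄 : PathCoreData)

/-- **The good parameters** of path `k`: inside `[0,1]`, image in the carrier and in no open square.
[folklore] -/
def F (k : Fin 𝔄.n) : Set ℝ := {t | t ∈ Icc (0 : ℝ) 1 ∧ 𝔄.γ k t ∈ 𝔄.Qc ∧ ∀ c, 𝔄.γ k t ∉ coreSq (𝔄.ctr c) (𝔄.rad c)}

variable {𝔄} {k : Fin 𝔄.n}

/-- `F_subset_Icc` (F subset Icc). [folklore] -/
theorem F_subset_Icc : 𝔄.F k ⊆ Icc 0 1 := fun _ h => h.1

/-- `isClosed_F` (isClosed F). [folklore] -/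
theorem isClosed_F (k : Fin 𝔄.n) : IsClosed (𝔄.F k) := by
  have h1 : IsClosed {t : ℝ | 𝔄.γ k t ∈ 𝔄.Qc} := 𝔄.Qc_closed.preimage (𝔄.γ_cont k)
  have h2 : IsClosed {t : ℝ | ∀ c, 𝔄.γ k t ∉ coreSq (𝔄.ctr c) (𝔄.rad c)} := by
    have : {t : ℝ | ∀ c, 𝔄.γ k t ∉ coreSq (𝔄.ctr c) (𝔄.rad c)} = ⋂ c, (𝔄.γ k) ⁻¹' (coreSq (𝔄.ctr c) (𝔄.rad c))ᶜ := by
      ext t; simp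
    rw [this]
    exact isClosed_iInter fun c => (isOpen_coreSq _ _).isClosed_compl.preimage (𝔄.γ_cont k)
  have : 𝔄.F k = Icc 0 1 ∩ ({t : ℝ | 𝔄.γ k t ∈ 𝔄.Qc} ∩ {t : ℝ | ∀ c, 𝔄.γ k t ∉ coreSq (𝔄.ctr c) (𝔄.rad c)}) := by
    ext t; simp [F, and_assoc]
  rw [this]
  exact isClosed_Icc.inter (h1.inter h2)

/-- `isBounded_F` (isBounded F). [folklore] -/
theorem isBounded_F (k : Fin 𝔄.n) : Bornology.IsBounded (𝔄.F k) :=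
  (isCompact_Icc (a := (0 : ℝ)) (b := 1)).isBounded.subset F_subset_Icc

/-- **The frontier of the good parameters is finite**: a good parameter strictly inside `(0,1)`
whose point is off the frontiers of the carrier and of the squares is an interior point. [folklore] -/
theorem finite_frontier_F (k : Fin 𝔄.n) : (frontier (𝔄.F k)).Finite := by
  refine Finite.subset (((finite_singleton (1 : ℝ)).insert 0).union
    (finite_iUnion fun c => 𝔄.fin_frontier_K k c)) fun t ht => ?_
  have hfr : frontier (𝔄.F k) = 𝔄.F k \ interior (𝔄.F k) := (isClosed_F k).frontier_eq
  rw [hfr] at ht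
  obtain ⟨htF, htint⟩ := ht
  have htI : t ∈ Icc (0 : ℝ) 1 := htF.1
  -- the point is off the frontier of the carrier: that frontier is met only inside the squares
  have hQ : 𝔄.γ k t ∉ frontier 𝔄.Qc := fun h => by
    obtain ⟨c, hc⟩ := 𝔄.frontier_Q_core k t htI h
    exact htF.2.2 c hc
  by_contra hnot
  simp only [mem_union, mem_insert_iff, mem_singleton_iff, mem_setOf_eq, mem_iUnion, not_or, not_exists,
    not_and] at hnot
  obtain ⟨⟨h0, h1⟩, hK⟩ := hnot
  apply htint
  -- an open neighbourhood of `γ t` inside the good region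
  set U : Set ℂ := interior 𝔄.Qc ∩ ⋂ c, (closure (coreSq (𝔄.ctr c) (𝔄.rad c)))ᶜ with hU
  have hUo : IsOpen U := isOpen_interior.inter (isOpen_iInter_of_finite fun c => isClosed_closure.isOpen_compl)
  have hγU : 𝔄.γ k t ∈ U := by
    refine ⟨?_, mem_iInter.2 fun c hc => ?_⟩
    · rw [𝔄.Qc_closed.frontier_eq] at hQ
      by_contra hni
      exact hQ ⟨htF.2.1, hni⟩
    · rw [closure_eq_self_union_frontier] at hc
      rcases hc with hc | hc
      · exact htF.2.2 c hc
      · exact hK c htI hc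
  have hV : Ioo (0 : ℝ) 1 ∩ 𝔄.γ k ⁻¹' U ∈ nhds t :=
    (isOpen_Ioo.inter (hUo.preimage (𝔄.γ_cont k))).mem_nhds
      ⟨⟨lt_of_le_of_ne htI.1 (Ne.symm h0), lt_of_le_of_ne htI.2 h1⟩, hγU⟩
  have hsub : Ioo (0 : ℝ) 1 ∩ 𝔄.γ k ⁻¹' U ⊆ 𝔄.F k := fun u ⟨hu, hγu⟩ =>
    ⟨Ioo_subset_Icc_self hu, interior_subset hγu.1, fun c hc => (mem_iInter.1 hγu.2 c) (subset_closure hc)⟩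
  exact mem_interior_iff_mem_nhds.2 (Filter.mem_of_superset hV hsub)

/-- Cut parameters are not good parameters. [folklore] -/
theorem cut_not_mem_F {t : ℝ} (ht : t ∈ 𝔄.CUT k) : t ∉ 𝔄.F k := fun h => by
  obtain ⟨c, hc⟩ := 𝔄.cut_bad k t ht h.2.1
  exact h.2.2 c hc

/-! ### The pieces -/

variable (𝔄) in
/-- **The piece** through the good parameter `t` of path `k`: the image of its component. [folklore] -/
def piece (k : Fin 𝔄.n) (t : ℝ) : Set ℂ := 𝔄.γ k '' connectedComponentIn (𝔄.F k) t

/-- The component of a good parameter is a closed interval of good parameters of variation `≤ η`,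
with the given parameter inside. [folklore] -/
theorem exists_Icc_of_mem_F {t : ℝ} (ht : t ∈ 𝔄.F k) : ∃ a b, a ≤ t ∧ t ≤ b ∧ connectedComponentIn (𝔄.F k) t = Icc a b ∧
    Icc a b ⊆ 𝔄.F k ∧ eVariationOn (𝔄.γ k) (Icc a b) ≤ ENNReal.ofReal 𝔄.η := by
  obtain ⟨a, b, hat, htb, hC, -, -⟩ := exists_Icc_eq_connectedComponentIn (isClosed_F k) (isBounded_F k) ht
  have hsub : Icc a b ⊆ 𝔄.F k := hC ▸ connectedComponentIn_subset _ _
  refine ⟨a, b, hat, htb, hC, hsub, ?_⟩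
  obtain ⟨s, hs, u, hu, hsa, hbu, hnone⟩ := exists_between_of_Icc_subset (D := 𝔄.CUT k) (fun d hd => cut_not_mem_F hd)
    (hat.trans htb) hsub ⟨0, 𝔄.cut_zero k, (hsub ⟨le_rfl, hat.trans htb⟩).1.1⟩ ⟨1, 𝔄.cut_one k, (hsub ⟨hat.trans htb, le_rfl⟩).1.2⟩
  exact (eVariationOn.mono _ (Icc_subset_Icc hsa.le hbu.le)).trans (𝔄.cut_var k s hs u hu (by linarith) hnone)

/-- **Pieces are compact.** [folklore] -/
theorem isCompact_piece {t : ℝ} (ht : t ∈ 𝔄.F k) : IsCompact (𝔄.piece k t) := by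
  obtain ⟨a, b, -, -, hC, -⟩ := exists_Icc_of_mem_F ht
  rw [piece, hC]
  exact isCompact_Icc.image (𝔄.γ_cont k)

/-- **Pieces are connected.** [folklore] -/
theorem isConnected_piece {t : ℝ} (ht : t ∈ 𝔄.F k) : IsConnected (𝔄.piece k t) := by
  obtain ⟨a, b, hat, htb, hC, -⟩ := exists_Icc_of_mem_F ht
  rw [piece, hC]
  exact (isConnected_Icc (hat.trans htb)).image _ (𝔄.γ_cont k).continuousOn

/-- The point of the parameter lies on its piece. [folklore] -/
theorem mem_piece_self {t : ℝ} (ht : t ∈ 𝔄.F k) : 𝔄.γ k t ∈ 𝔄.piece k t :=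
  ⟨t, mem_connectedComponentIn ht, rfl⟩

/-- Pieces lie in the image of the good parameters. [folklore] -/
theorem piece_subset {t : ℝ} : 𝔄.piece k t ⊆ 𝔄.γ k '' 𝔄.F k :=
  image_mono (connectedComponentIn_subset _ _)

/-- **Pieces have diameter at most `η`.** [folklore] -/
theorem dist_le_of_mem_piece (hη : 0 ≤ 𝔄.η) {t : ℝ} (ht : t ∈ 𝔄.F k) {x y : ℂ} (hx : x ∈ 𝔄.piece k t) (hy : y ∈ 𝔄.piece k t) :
    dist x y ≤ 𝔄.η := by
  obtain ⟨a, b, -, -, hC, -, hvar⟩ := exists_Icc_of_mem_F ht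
  rw [piece, hC] at hx hy
  obtain ⟨u, hu, rfl⟩ := hx
  obtain ⟨v, hv, rfl⟩ := hy
  have h := eVariationOn.edist_le (𝔄.γ k) hu hv
  rw [edist_dist] at h
  have h' := h.trans hvar
  exact (ENNReal.ofReal_le_ofReal_iff hη).1 h'

/-- **Distinct pieces are disjoint**: a common point of two pieces is either on one component (then
the pieces coincide) or a multiple point of the cut (inside a square, not a good point). [folklore] -/
theorem disjoint_piece {k k' : Fin 𝔄.n} {t t' : ℝ}
    (hne : 𝔄.piece k t ≠ 𝔄.piece k' t') : Disjoint (𝔄.piece k t) (𝔄.piece k' t') := by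
  rw [Set.disjoint_left]
  rintro z ⟨u, hu, rfl⟩ ⟨v, hv, hzv⟩
  have huF : u ∈ 𝔄.F k := connectedComponentIn_subset _ _ hu
  have hvF : v ∈ 𝔄.F k' := connectedComponentIn_subset _ _ hv
  by_cases h : k = k' ∧ u = v
  · obtain ⟨rfl, rfl⟩ := h
    apply hne
    rw [piece, piece, connectedComponentIn_eq hu, connectedComponentIn_eq hv]
  · have h' : k' ≠ k ∨ v ≠ u := by tauto
    obtain ⟨c, hc⟩ := 𝔄.multiple k' k v u hvF.1 huF.1 h' hzv
    exact hvF.2.2 c hc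

variable (𝔄) in
/-- **The set of all pieces.** [folklore] -/
def pieces : Set (Set ℂ) := {S | ∃ k, ∃ t ∈ 𝔄.F k, S = 𝔄.piece k t}

/-- **The pieces are finitely many.** [folklore] -/
theorem finite_pieces : 𝔄.pieces.Finite := by
  have : 𝔄.pieces ⊆ ⋃ k, (fun C => 𝔄.γ k '' C) '' {C : Set ℝ | ∃ x ∈ 𝔄.F k, C = connectedComponentIn (𝔄.F k) x} := by
    rintro S ⟨k, t, ht, rfl⟩
    exact mem_iUnion.2 ⟨k, _, ⟨t, ht, rfl⟩, rfl⟩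
  exact (finite_iUnion fun k => (finite_setOf_connectedComponentIn (isClosed_F k) (isBounded_F k) (finite_frontier_F k)).image _).subset this

/-- Every good point lies on a piece. [folklore] -/
theorem exists_mem_pieces {t : ℝ} (ht : t ∈ 𝔄.F k) : ∃ S ∈ 𝔄.pieces, 𝔄.γ k t ∈ S :=
  ⟨𝔄.piece k t, ⟨k, t, ht, rfl⟩, mem_piece_self ht⟩

/-- Every piece is compact, connected, of diameter `≤ η`, inside the image of the good parameters of
some path. [folklore] -/
theorem pieces_facts (hη : 0 ≤ 𝔄.η) {S : Set ℂ} (hS : S ∈ 𝔄.pieces) :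
    IsCompact S ∧ IsConnected S ∧ (∀ x ∈ S, ∀ y ∈ S, dist x y ≤ 𝔄.η) ∧ ∃ k, S ⊆ 𝔄.γ k '' 𝔄.F k := by
  obtain ⟨k, t, ht, rfl⟩ := hS
  exact ⟨isCompact_piece ht, isConnected_piece ht, fun x hx y hy => dist_le_of_mem_piece hη ht hx hy, k, piece_subset⟩

/-- Distinct pieces are disjoint. [folklore] -/
theorem pieces_disjoint {S S' : Set ℂ} (hS : S ∈ 𝔄.pieces) (hS' : S' ∈ 𝔄.pieces) (hne : S ≠ S') : Disjoint S S' := by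
  obtain ⟨k, t, -, rfl⟩ := hS
  obtain ⟨k', t', -, rfl⟩ := hS'
  exact disjoint_piece hne

/-! ### Enumeration and separation -/

variable (𝔄) in
/-- The number of pieces. [folklore] -/
def N : ℕ := finite_pieces (𝔄 := 𝔄) |>.toFinset.card

variable (𝔄) in
/-- **The enumeration of the pieces.** [folklore] -/
def P (m : Fin 𝔄.N) : Set ℂ := ((finite_pieces (𝔄 := 𝔄)).toFinset.equivFin.symm m).1

/-- Enumerated pieces are pieces. [folklore] -/
theorem P_mem (m : Fin 𝔄.N) : 𝔄.P m ∈ 𝔄.pieces :=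
  (finite_pieces (𝔄 := 𝔄)).mem_toFinset.1 ((finite_pieces (𝔄 := 𝔄)).toFinset.equivFin.symm m).2

/-- The enumeration is injective. [folklore] -/
theorem P_injective : Function.Injective 𝔄.P := fun _ _ h =>
  (finite_pieces (𝔄 := 𝔄)).toFinset.equivFin.symm.injective (Subtype.ext h)

/-- Every piece is enumerated. [folklore] -/
theorem exists_P_eq {S : Set ℂ} (hS : S ∈ 𝔄.pieces) : ∃ m, 𝔄.P m = S := by
  refine ⟨(finite_pieces (𝔄 := 𝔄)).toFinset.equivFin ⟨S, (finite_pieces (𝔄 := 𝔄)).mem_toFinset.2 hS⟩, ?_⟩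
  simp [P]

/-- Enumerated pieces are compact. [folklore] -/
theorem isCompact_P (m : Fin 𝔄.N) : IsCompact (𝔄.P m) := by
  obtain ⟨k, t, ht, h⟩ := P_mem m
  rw [h]; exact isCompact_piece ht

/-- **The pieces are uniformly separated.** [folklore] -/
theorem exists_separation : ∃ g > 0, ∀ m m', m ≠ m' → ∀ x ∈ 𝔄.P m, ∀ y ∈ 𝔄.P m', g ≤ dist x y :=
  exists_pos_forall_le_dist 𝔄.P isCompact_P fun m m' hne => pieces_disjoint (P_mem m) (P_mem m') fun h => hne (P_injective h)

end PathCoreData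

end StripPieces

end Literature.Probability.Percolation

end
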